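import Summits.KontsevichZagierPeriods.KontsevichZagierPeriods.Theorems.SoloBlindTanHalf
import HarnessLib

/-!
# The cyclic tangent chart, II: the algebraic inverse and the move

The cyclic tangent chart `Φ(t)ᵢ = S(tᵢ)/C(tᵢ₊₁)` of `SoloBlindTanHalf` is a bijection of the
tangent cell `T = {0 < tᵢ, tᵢ + tᵢ₊₁ + tᵢtᵢ₊₁ < 1}` ONTO the open box `(0,1)⁴`, with an explicit
algebraic inverse: writing `σᵢ = S(tᵢ)²`, the relations `xᵢ² C(tᵢ₊₁)² = S(tᵢ)²` form the cyclic
linear system `σᵢ + xᵢ² σᵢ₊₁ = xᵢ²`, whose determinant is `1 - (x₀x₁x₂x₃)² ≠ 0` and whose solution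
is `σᵢ = xᵢ²(1 - xᵢ₊₁²(1 - xᵢ₊₂²(1 - xᵢ₊₃²)))/(1 - (x₀x₁x₂x₃)²) ∈ (0,1)`; then
`tᵢ = √σᵢ/(1 + √(1-σᵢ))` (half-angle inversion).

* `tanSigma`, `tanInv`, `tanInv_tanChart`, `tanChart_tanInv`, `tanInv_mem`;
* `injOn_tanChart`, `image_tanChart : Φ '' T = (0,1)⁴`, `isSemialgebraicMapOn_tanChart`;
* `equivalent_of_tanChart`: the data of ONE change of variables in Kontsevich–Zagier's rule (2),
  `[T, g(Φ t)·(1 - (∏Φᵢ)²)·∏W(tᵢ)] ≡ [(0,1)⁴, g]`, and the matching integrability transfer.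

References: Beukers–Kolk–Calabi (1993); Kontsevich–Zagier, *Periods* (2001), §1.2.
-/

noncomputable section

namespace Summit.KontsevichZagierPeriods.KontsevichZagierPeriods.Theorems

open Set MeasureTheory
open Literature.ModelTheory.ExponentialFields (IsSemialgebraic isSemialgebraic_setOf_eval_pos)
open MvPolynomial (aeval X C)
open Literature.NumberTheory.Transcendental
open Literature.NumberTheory.Transcendental.KZ

namespace SoloBlind

/-! ## The algebraic inverse -/

/-- The determinant `D(x) = 1 - (x₀x₁x₂x₃)²` of the cyclic system. -/
def tanDen (x : Fin 4 → ℝ) : ℝ := 1 - (x 0 * x 1 * x 2 * x 3) ^ 2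

/-- The solution `σ(x)` of the cyclic system `σᵢ + xᵢ² σᵢ₊₁ = xᵢ²`. -/
def tanSigma (x : Fin 4 → ℝ) : Fin 4 → ℝ :=
  ![x 0 ^ 2 * (1 - x 1 ^ 2 * (1 - x 2 ^ 2 * (1 - x 3 ^ 2))) / tanDen x,
    x 1 ^ 2 * (1 - x 2 ^ 2 * (1 - x 3 ^ 2 * (1 - x 0 ^ 2))) / tanDen x,
    x 2 ^ 2 * (1 - x 3 ^ 2 * (1 - x 0 ^ 2 * (1 - x 1 ^ 2))) / tanDen x,
    x 3 ^ 2 * (1 - x 0 ^ 2 * (1 - x 1 ^ 2 * (1 - x 2 ^ 2))) / tanDen x]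

/-- **The inverse chart** `Ψ(x)ᵢ = √σᵢ / (1 + √(1 - σᵢ))`. -/
def tanInv (x : Fin 4 → ℝ) : Fin 4 → ℝ := fun i =>
  √(tanSigma x i) / (1 + √(1 - tanSigma x i))

/-- On the open box `D(x) > 0`. -/
theorem tanDen_pos {x : Fin 4 → ℝ} (hx : x ∈ kzOpenBox 4) : 0 < tanDen x := by
  have hP := BoxIntegral.prod_mem_Ioo (by norm_num) hx
  rw [Fin.prod_univ_four] at hP
  unfold tanDen
  nlinarith [hP.1, hP.2]

/-- One nesting step: `u ∈ (0,1)`, `v ∈ (0,1]` give `1 - u²v ∈ (0,1)`. -/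
theorem nest_mem {u v : ℝ} (hu : u ∈ Ioo (0 : ℝ) 1) (hv0 : 0 < v) (hv1 : v ≤ 1) :
    1 - u ^ 2 * v ∈ Ioo (0 : ℝ) 1 := by
  have h1 : 0 < u ^ 2 * v := mul_pos (pow_pos hu.1 2) hv0
  have h2 : u ^ 2 * v < 1 := by nlinarith [hu.1, hu.2]
  exact ⟨by linarith, by linarith⟩

/-- **The cyclic system**: `σᵢ + xᵢ² σᵢ₊₁ = xᵢ²`. -/
theorem tanSigma_rec {x : Fin 4 → ℝ} (hD : tanDen x ≠ 0) (i : Fin 4) :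
    tanSigma x i + x i ^ 2 * tanSigma x (i + 1) = x i ^ 2 := by
  have key : ∀ N M c : ℝ, N + c * M = c * tanDen x →
      N / tanDen x + c * (M / tanDen x) = c := by
    intro N M c h
    field_simp
    linear_combination h
  fin_cases i <;>
    simp only [tanSigma, Fin.zero_eta, Fin.mk_one, Fin.reduceFinMk, Fin.isValue, Fin.reduceAdd,
      Matrix.cons_val_zero, Matrix.cons_val_one, Matrix.cons_val] <;>
    exact key _ _ _ (by unfold tanDen; ring)

/-- On the open box `σᵢ ∈ (0,1)`. -/
theorem tanSigma_mem {x : Fin 4 → ℝ} (hx : x ∈ kzOpenBox 4) (i : Fin 4) :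
    tanSigma x i ∈ Ioo (0 : ℝ) 1 := by
  have hD := tanDen_pos hx
  have key : ∀ a b c d : Fin 4, tanDen x = 1 - (x a * x b * x c * x d) ^ 2 →
      x a ^ 2 * (1 - x b ^ 2 * (1 - x c ^ 2 * (1 - x d ^ 2))) / tanDen x ∈ Ioo (0 : ℝ) 1 := by
    intro a b c d hden
    have hv3 := nest_mem (hx d) one_pos le_rfl
    rw [mul_one] at hv3
    have hv2 := nest_mem (hx c) hv3.1 hv3.2.le
    have hv1 := nest_mem (hx b) hv2.1 hv2.2.le
    refine ⟨div_pos (mul_pos (pow_pos (hx a).1 2) hv1.1) hD, (div_lt_one hD).mpr ?_⟩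
    have hgap : tanDen x - x a ^ 2 * (1 - x b ^ 2 * (1 - x c ^ 2 * (1 - x d ^ 2))) =
        (1 - x a ^ 2) + x a ^ 2 * x b ^ 2 * (1 - x c ^ 2) := by
      rw [hden]; ring
    have h1 : x a ^ 2 < 1 := pow_lt_one₀ (hx a).1.le (hx a).2 two_ne_zero
    have h2 : 0 ≤ x a ^ 2 * x b ^ 2 * (1 - x c ^ 2) :=
      mul_nonneg (mul_nonneg (sq_nonneg _) (sq_nonneg _))
        (by linarith [pow_lt_one₀ (hx c).1.le (hx c).2 two_ne_zero])
    nlinarith [hgap, h1, h2]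
  fin_cases i
  · exact key 0 1 2 3 rfl
  · exact key 1 2 3 0 (by unfold tanDen; ring)
  · exact key 2 3 0 1 (by unfold tanDen; ring)
  · exact key 3 0 1 2 (by unfold tanDen; ring)

section inverse

variable {x : Fin 4 → ℝ} (hx : x ∈ kzOpenBox 4)
include hx

/-- `s = √σᵢ` and `c = √(1-σᵢ)`: `0 < s < 1`, `0 < c`, `s² + c² = 1`, `c² = 1 - σᵢ`. -/
theorem tanInv_aux (i : Fin 4) :
    0 < √(tanSigma x i) ∧ √(tanSigma x i) < 1 ∧ 0 < √(1 - tanSigma x i) ∧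
      √(tanSigma x i) ^ 2 + √(1 - tanSigma x i) ^ 2 = 1 ∧
        √(1 - tanSigma x i) ^ 2 = 1 - tanSigma x i := by
  have hσ := tanSigma_mem hx i
  have h1 : √(tanSigma x i) < 1 := by
    rw [show (1 : ℝ) = √1 from Real.sqrt_one.symm]
    exact Real.sqrt_lt_sqrt hσ.1.le hσ.2
  refine ⟨Real.sqrt_pos.mpr hσ.1, h1, Real.sqrt_pos.mpr (by linarith [hσ.2]), ?_, ?_⟩
  · rw [Real.sq_sqrt hσ.1.le, Real.sq_sqrt (by linarith [hσ.2])]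
    ring
  · exact Real.sq_sqrt (by linarith [hσ.2])

/-- `S(Ψ(x)ᵢ) = √σᵢ` and `C(Ψ(x)ᵢ) = √(1-σᵢ)`. -/
theorem tS_tC_tanInv (i : Fin 4) :
    tS (tanInv x i) = √(tanSigma x i) ∧ tC (tanInv x i) = √(1 - tanSigma x i) := by
  obtain ⟨_, _, hc, hsc, _⟩ := tanInv_aux hx i
  exact tS_tC_half_angle (by linarith) hsc

/-- `√σᵢ = xᵢ · √(1 - σᵢ₊₁)` (the cyclic system, square-rooted). -/
theorem sqrt_tanSigma_eq (i : Fin 4) :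
    √(tanSigma x i) = x i * √(1 - tanSigma x (i + 1)) := by
  obtain ⟨hs, _, _, _, _⟩ := tanInv_aux hx i
  obtain ⟨_, _, hc', _, hc'2⟩ := tanInv_aux hx (i + 1)
  have hrec := tanSigma_rec (tanDen_pos hx).ne' i
  refine (sq_eq_sq₀ hs.le (mul_nonneg (hx i).1.le hc'.le)).mp ?_
  rw [Real.sq_sqrt (tanSigma_mem hx i).1.le, mul_pow, hc'2]
  linarith

/-- **`Φ ∘ Ψ = id` on the open box.** -/
theorem tanChart_tanInv : tanChart (tanInv x) = x := by
  funext i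
  obtain ⟨_, _, hc', _, _⟩ := tanInv_aux hx (i + 1)
  rw [tanChart_apply, (tS_tC_tanInv hx i).1, (tS_tC_tanInv hx (i + 1)).2, sqrt_tanSigma_eq hx i,
    mul_div_cancel_right₀ _ hc'.ne']

/-- **`Ψ` maps the open box into the tangent cell.** -/
theorem tanInv_mem : tanInv x ∈ tanCell := by
  intro i
  obtain ⟨hs, hs1, hc, _, _⟩ := tanInv_aux hx i
  obtain ⟨_, _, hc', _, _⟩ := tanInv_aux hx (i + 1)
  have ht0 : 0 < tanInv x i := div_pos hs (by linarith)
  have ht1 : tanInv x i < 1 := (div_lt_one (by linarith)).mpr (by linarith)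
  have ht0' : 0 < tanInv x (i + 1) := div_pos (tanInv_aux hx (i + 1)).1 (by linarith)
  refine ⟨ht0, (tS_lt_tC_iff ht0.le ht1 ht0'.le).mp ?_⟩
  rw [(tS_tC_tanInv hx i).1, (tS_tC_tanInv hx (i + 1)).2, sqrt_tanSigma_eq hx i]
  exact mul_lt_of_lt_one_left hc' (hx i).2

end inverse

/-- On the cell, `σ(Φ(t))ᵢ = S(tᵢ)²` (uniqueness of the solution of the cyclic system). -/
theorem tanSigma_tanChart {t : Fin 4 → ℝ} (ht : t ∈ tanCell) (i : Fin 4) :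
    tanSigma (tanChart t) i = tS (t i) ^ 2 := by
  set x := tanChart t with hx
  have hD : tanDen x ≠ 0 := (tanDen_pos (tanChart_mem ht)).ne'
  have e0 : x 0 ^ 2 * (1 - tS (t 1) ^ 2) = tS (t 0) ^ 2 := tanChart_sq_mul ht 0
  have e1 : x 1 ^ 2 * (1 - tS (t 2) ^ 2) = tS (t 1) ^ 2 := tanChart_sq_mul ht 1
  have e2 : x 2 ^ 2 * (1 - tS (t 3) ^ 2) = tS (t 2) ^ 2 := tanChart_sq_mul ht 2
  have e3 : x 3 ^ 2 * (1 - tS (t 0) ^ 2) = tS (t 3) ^ 2 := tanChart_sq_mul ht 3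
  unfold tanDen at hD
  fin_cases i
  · simp only [tanSigma, Fin.zero_eta, Fin.isValue, Matrix.cons_val_zero]
    unfold tanDen
    rw [div_eq_iff hD]
    linear_combination e0 - x 0 ^ 2 * e1 + x 0 ^ 2 * x 1 ^ 2 * e2 -
      x 0 ^ 2 * x 1 ^ 2 * x 2 ^ 2 * e3
  · simp only [tanSigma, Fin.mk_one, Fin.isValue, Matrix.cons_val_one, Matrix.cons_val_zero]
    unfold tanDen
    rw [div_eq_iff hD]
    linear_combination e1 - x 1 ^ 2 * e2 + x 1 ^ 2 * x 2 ^ 2 * e3 -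
      x 1 ^ 2 * x 2 ^ 2 * x 3 ^ 2 * e0
  · simp only [tanSigma, Fin.reduceFinMk, Matrix.cons_val]
    unfold tanDen
    rw [div_eq_iff hD]
    linear_combination e2 - x 2 ^ 2 * e3 + x 2 ^ 2 * x 3 ^ 2 * e0 -
      x 2 ^ 2 * x 3 ^ 2 * x 0 ^ 2 * e1
  · simp only [tanSigma, Fin.reduceFinMk, Matrix.cons_val]
    unfold tanDen
    rw [div_eq_iff hD]
    linear_combination e3 - x 3 ^ 2 * e0 + x 3 ^ 2 * x 0 ^ 2 * e1 -
      x 3 ^ 2 * x 0 ^ 2 * x 1 ^ 2 * e2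

/-- **`Ψ ∘ Φ = id` on the cell** (half-angle inversion). -/
theorem tanInv_tanChart {t : Fin 4 → ℝ} (ht : t ∈ tanCell) : tanInv (tanChart t) = t := by
  funext i
  have hS : 0 ≤ tS (t i) := tS_nonneg (ht i).1.le
  have hC : 0 ≤ tC (t i) := (tC_pos_of_mem_tanCell ht i).le
  simp only [tanInv, tanSigma_tanChart ht, one_sub_tS_sq, Real.sqrt_sq hS, Real.sqrt_sq hC]
  exact tS_div_one_add_tC (t i)

/-- **The chart is injective on the cell.** -/
theorem injOn_tanChart : InjOn tanChart tanCell := fun a ha b hb h => by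
  rw [← tanInv_tanChart ha, ← tanInv_tanChart hb, h]

/-- **The chart maps the cell ONTO the open box.** -/
theorem image_tanChart : tanChart '' tanCell = kzOpenBox 4 := by
  refine Subset.antisymm (image_subset_iff.mpr fun t ht => tanChart_mem ht) fun x hx => ?_
  exact ⟨tanInv x, tanInv_mem hx, tanChart_tanInv hx⟩

/-- The chart is a `ℚ`-semialgebraic (indeed `ℚ`-rational) map on the cell. -/
theorem isSemialgebraicMapOn_tanChart : IsSemialgebraicMapOn ℚ tanCell tanChart := by
  refine IsSemialgebraicMapOn.of_forall isSemialgebraic_tanCell fun i => ?_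
  have hq : ∀ t ∈ tanCell, aeval t ((1 + X i ^ 2) * (1 - X (i + 1) ^ 2) :
      MvPolynomial (Fin 4) ℚ) ≠ 0 := by
    intro t ht
    have h1 : (0 : ℝ) < 1 + t i ^ 2 := by positivity
    have h2 : (0 : ℝ) < 1 - t (i + 1) ^ 2 := by
      nlinarith [(ht (i + 1)).1, lt_one_of_mem_tanCell ht (i + 1)]
    simpa using (mul_pos h1 h2).ne'
  refine (isSemialgebraicFunOn_aeval_div_aeval isSemialgebraic_tanCell
    (C 2 * X i * (1 + X (i + 1) ^ 2)) ((1 + X i ^ 2) * (1 - X (i + 1) ^ 2)) hq).congr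
    fun t _ => ?_
  simp only [tanChart_apply, tS, tC, map_mul, map_add, map_sub, map_pow, map_one,
    MvPolynomial.aeval_C, MvPolynomial.aeval_X, eq_ratCast, Rat.cast_ofNat]
  rw [div_div_div_eq]

/-- **One move of rule (2) along the cyclic tangent chart**: a representation pinned as
`[T, t ↦ g(Φ t)·(1 - (∏ᵢΦ(t)ᵢ)²)·∏ᵢW(tᵢ)]` is equivalent to one pinned as `[(0,1)⁴, g]`. -/
theorem equivalent_of_tanChart {r r' : IntegralRep 4} {f g : (Fin 4 → ℝ) → ℝ}
    (hfg : ∀ t ∈ tanCell,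
      f t = g (tanChart t) * ((1 - (∏ i, tanChart t i) ^ 2) * ∏ i, tW (t i)))
    (hrd : r.domain = tanCell) (hri : EqOn r.integrand f tanCell)
    (hr'd : r'.domain = kzOpenBox 4) (hr'i : EqOn r'.integrand g (kzOpenBox 4)) :
    Equivalent r r' :=
  equivalent_of_chart isSemialgebraicMapOn_tanChart (fun _ ht => hasFDerivAt_tanChart ht)
    injOn_tanChart image_tanChart (fun _ ht => abs_det_tanDeriv ht) hfg hrd hri hr'd hr'i

/-- Integrability transfer along the cyclic tangent chart. -/
theorem integrableOn_tanCell_iff {f g : (Fin 4 → ℝ) → ℝ}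
    (hfg : ∀ t ∈ tanCell,
      f t = g (tanChart t) * ((1 - (∏ i, tanChart t i) ^ 2) * ∏ i, tW (t i))) :
    IntegrableOn g (kzOpenBox 4) ↔ IntegrableOn f tanCell := by
  rw [← image_tanChart]
  exact integrableOn_iff_of_chart measurableSet_tanCell (fun _ ht => hasFDerivAt_tanChart ht)
    injOn_tanChart (fun _ ht => abs_det_tanDeriv ht) hfg

end SoloBlind

end Summit.KontsevichZagierPeriods.KontsevichZagierPeriods.Theorems
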